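import Mathlib.Analysis.SpecialFunctions.Integrals.Basic
import Literature.NumberTheory.Transcendental.EllIterRep
import Summits.KontsevichZagierPeriods.KontsevichZagierPeriods.Theorems.HurwitzMicroSectorsNormalFormPrincipleDlogMoves

/-!
# `NormalFormPrinciple` (stmt-KontsevichZagierPeriods-3869), line `SketchIdeator1` —
# registered sub-goal `carrierA_mul_mem_relations` (siege attempt k8: the two-move certificate)

Pure proof file (`--supports` the crux stmt-KontsevichZagierPeriods-3869). It proves the registered
sub-goal `carrierA_mul_mem_relations` of the algebraic-pole layer of the leaf `stub_boxRigidity`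
BY NAME AND SIGNATURE: **multiplicativity of the dlog carriers** `Λ(u, c) := [(1, u), c/y]` with
real algebraic data,

  `[Λ(u v, c)] − [Λ(u, c)] − [Λ(v, c)] ∈ KZ.relations`   (`1 ≤ u`, `1 ≤ v`, `u, v, c` algebraic),

the KZ-move shadow of `log (u v) = log u + log v`. The certificate is FINITE and transcendence-free —
exactly two moves of [Kontsevich–Zagier 2001, §1.2] through one intermediate representation
`M := [(u, u v), c/y]`:

* rule (1a) + a null point: `[(1, u v)] ≡ [(1, u)] + [(u, u v)]` (`Dlog.split_mem_relations`,
  valid also in the degenerate cases `u = 1` / `v = 1`, where a slab is empty);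
* rule (2), the dilation `y ↦ u y` of Jacobian `u`: `[(1, v), c/y] ≡ [(u, u v), c/y]`
  (scaling by a real ALGEBRAIC factor — the chart `y ↦ u y` is `ℚ`-semialgebraic because a real
  algebraic constant is a `ℚ`-semialgebraic function, `aff_isSemialgebraicMapOn_chart`);

and `relations` is a subgroup. The two private lemmas (existence of `M`, the algebraic dilation)
are the algebraic-data variants of `Dlog.exists_dlog` / `Dlog.dlog_scale_mem_relations`.
No definitions are introduced. Sources: M. Kontsevich, D. Zagier, *Periods* (2001), §1.1, §1.2.
-/

noncomputable section

open MeasureTheory Set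
open Literature.NumberTheory.Transcendental Literature.NumberTheory.Transcendental.KZ
open Literature.ModelTheory.ExponentialFields (IsSemialgebraic)

namespace Summit.KontsevichZagierPeriods.HurwitzMicroSectors.NormalFormPrinciple.PiBox

namespace Dlog

namespace CarrierSiegeK8

open Summit.KontsevichZagierPeriods.KontsevichZagierPeriods.BetaCancellationLine
  (aff_hasFDerivAt_chart aff_abs_det_chartDeriv aff_injective_chart aff_isSemialgebraicMapOn_chart)
open Summit.KontsevichZagierPeriods.HurwitzMicroSectors.NormalFormPrinciple.Negative
  (integrableOn_fin_one)

/-- Existence of the dlog representation `[(a, b), c/y]` for real algebraic `a, b, c`, `0 < a`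
(algebraic-data variant of `Dlog.exists_dlog`). [cite: KontsevichZagier2001, §1.1] -/
private theorem exists_dlog_alg {a b c : ℝ} (ha : IsAlgebraic ℚ a) (hb : IsAlgebraic ℚ b)
    (hc : IsAlgebraic ℚ c) (ha0 : 0 < a) :
    ∃ L : IntegralRep 1, L.domain = {x | x 0 ∈ Set.Ioo a b} ∧ L.integrand = fun x => c / x 0 := by
  have hdom : IsSemialgebraic ℚ {x : Fin 1 → ℝ | x 0 ∈ Set.Ioo a b} := by
    have h : {x : Fin 1 → ℝ | x 0 ∈ Set.Ioo a b} = {x : Fin 1 → ℝ | a < x 0} ∩ {x | x 0 < b} := by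
      ext x; simp
    rw [h]
    exact (isSemialgebraic_setOf_const_lt_apply ha 0).inter (isSemialgebraic_setOf_apply_lt_const hb 0)
  have hpos : ∀ x ∈ {x : Fin 1 → ℝ | x 0 ∈ Set.Ioo a b}, 0 < x 0 := fun x hx => lt_trans ha0 hx.1
  have hinv : IsSemialgebraicFunOn ℚ {x : Fin 1 → ℝ | x 0 ∈ Set.Ioo a b} (fun x => 1 / x 0) := by
    refine (isSemialgebraicFunOn_aeval_div_aeval hdom (1 : MvPolynomial (Fin 1) ℚ)
      (MvPolynomial.X 0) fun x hx => ?_).congr fun x _ => ?_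
    · simp only [MvPolynomial.aeval_X]; exact (hpos x hx).ne'
    · simp
  have hsa : IsSemialgebraicFunOn ℚ {x : Fin 1 → ℝ | x 0 ∈ Set.Ioo a b} (fun x => c / x 0) :=
    (IsSemialgebraicFunOn.mul_holds (isSemialgebraicFunOn_const_of_isAlgebraic hdom hc) hinv).congr
      fun x _ => by rw [Pi.mul_apply]; ring
  have hint : IntegrableOn (fun x : Fin 1 → ℝ => c / x 0) {x : Fin 1 → ℝ | x 0 ∈ Set.Ioo a b} := by
    rw [integrableOn_fin_one]
    have hcont : ContinuousOn (fun t : ℝ => c / t) (Set.Icc a b) :=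
      continuousOn_const.div continuousOn_id fun t ht => (lt_of_lt_of_le ha0 ht.1).ne'
    exact (hcont.integrableOn_compact isCompact_Icc).mono_set Set.Ioo_subset_Icc_self
  exact ⟨⟨_, _, hdom, hsa, hint⟩, rfl, rfl⟩

/-- Scaling by a real algebraic factor `s > 0` (rule 2, dilation `y ↦ s y`, Jacobian `s`):
`[(a, b), c/y] − [(s a, s b), c/y] ∈ relations` for `0 < a` (algebraic-data variant of
`Dlog.dlog_scale_mem_relations`). [cite: KontsevichZagier2001, §1.2 rule (2)] -/
private theorem dlog_scale_alg_mem_relations {a b c s : ℝ} (hs : IsAlgebraic ℚ s)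
    (L L' : IntegralRep 1) (hd : L.domain = {x | x 0 ∈ Set.Ioo a b})
    (hd' : L'.domain = {x | x 0 ∈ Set.Ioo (s * a) (s * b)})
    (hi : EqOn L.integrand (fun x => c / x 0) L.domain)
    (hi' : EqOn L'.integrand (fun x => c / x 0) L'.domain) (ha0 : 0 < a) (hs0 : 0 < s) :
    of L - of L' ∈ relations := by
  have himage : L'.domain = (fun y : Fin 1 → ℝ => fun _ : Fin 1 => s * y 0 + 0) '' L.domain := by
    rw [hd, image_smul_slab hs0, hd']
  refine changeOfVariablesRel_subset_relations
    ⟨1, L, L', fun y : Fin 1 → ℝ => fun _ : Fin 1 => s * y 0 + 0,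
      fun _ => s • ContinuousLinearMap.id ℝ (Fin 1 → ℝ),
      aff_isSemialgebraicMapOn_chart L.isSemialgebraic_domain isAlgebraic_zero hs,
      fun x _ => (aff_hasFDerivAt_chart s 0 x).hasFDerivWithinAt,
      (aff_injective_chart hs0.ne' 0).injOn, himage, fun x hx => ?_, rfl⟩
  have hΦx : (fun _ : Fin 1 => s * x 0 + 0) ∈ L'.domain := himage ▸ Set.mem_image_of_mem _ hx
  have hx0 : (0:ℝ) < x 0 := by rw [hd] at hx; exact lt_trans ha0 hx.1
  rw [hi hx, hi' hΦx, aff_abs_det_chartDeriv hs0]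
  simp only [add_zero]
  field_simp

/-- **Multiplicativity of the algebraic dlog carriers** (registered sub-goal
`carrierA_mul_mem_relations` of crux stmt-KontsevichZagierPeriods-3869, line `SketchIdeator1`):
for any family `R a b c = [(a, b), c/y]` of dlog representations with real algebraic data and
real algebraic `u, v ≥ 1`, `c`,
`[R 1 (u v) c] − [R 1 u c] − [R 1 v c] ∈ KZ.relations` — split `(1, u v)` at `u` (rule 1) and
rescale `(1, v)` onto `(u, u v)` by `y ↦ u y` (rule 2).
[cite: KontsevichZagier2001, §1.2 rules (1), (2)] -/
theorem carrierA_mul_mem_relations {R : ℝ → ℝ → ℝ → IntegralRep 1}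
    (hR : ∀ a b c, IsAlgebraic ℚ a → IsAlgebraic ℚ b → IsAlgebraic ℚ c → 0 < a →
      (R a b c).domain = {x | x 0 ∈ Set.Ioo a b} ∧ (R a b c).integrand = fun x => c / x 0)
    {u v c : ℝ} (hu : IsAlgebraic ℚ u) (hv : IsAlgebraic ℚ v) (hc : IsAlgebraic ℚ c)
    (hu1 : 1 ≤ u) (hv1 : 1 ≤ v) :
    of (R 1 (u * v) c) - of (R 1 u c) - of (R 1 v c) ∈ relations := by
  have hu0 : (0:ℝ) < u := lt_of_lt_of_le one_pos hu1
  have huv : IsAlgebraic ℚ (u * v) := hu.mul hv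
  -- the three carriers, by the defining property of the family `R`
  obtain ⟨hd, hi⟩ := hR 1 (u * v) c isAlgebraic_one huv hc one_pos
  obtain ⟨hdu, hiu⟩ := hR 1 u c isAlgebraic_one hu hc one_pos
  obtain ⟨hdv, hiv⟩ := hR 1 v c isAlgebraic_one hv hc one_pos
  -- the intermediate representation `M = [(u, u v), c/y]`
  obtain ⟨M, hMd, hMi⟩ := exists_dlog_alg hu huv hc hu0
  -- rule (1): split `(1, u v)` at `u` (`1 ≤ u ≤ u v`)
  have hsplit : of (R 1 (u * v) c) - of (R 1 u c) - of M ∈ relations :=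
    split_mem_relations (R 1 (u * v) c) (R 1 u c) M hd hdu hMd hu1
      (le_mul_of_one_le_right hu0.le hv1)
      (fun x _ => by rw [hiu, hi]) (fun x _ => by rw [hMi, hi])
  -- rule (2): `[(1, v), c/y] − [(u·1, u·v), c/y] ∈ relations`
  have hscale : of (R 1 v c) - of M ∈ relations :=
    dlog_scale_alg_mem_relations (a := 1) (b := v) (c := c) (s := u) hu (R 1 v c) M hdv
      (by rw [hMd, mul_one]) (fun x _ => by rw [hiv]) (fun x _ => by rw [hMi]) one_pos hu0
  have heq : of (R 1 (u * v) c) - of (R 1 u c) - of (R 1 v c) =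
      (of (R 1 (u * v) c) - of (R 1 u c) - of M) - (of (R 1 v c) - of M) := by abel
  rw [heq]
  exact relations.sub_mem hsplit hscale

end CarrierSiegeK8

end Dlog

end Summit.KontsevichZagierPeriods.HurwitzMicroSectors.NormalFormPrinciple.PiBox
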